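import Mathlib
import HarnessLib

/-!
# Half-degree lemma, part A: the atom recursion (algebraic core)

Support file for the crux `TracialDecayExp20` (stmt-PneNP-19878) of route `ChebyshevTracialDesign`
(cell pnp-psdrank; prover R1-SKELETON S3(ii) «deg_c σ_k ≤ k/2», p1 ROUND-2 §2(v) HALF-DEGREE LEMMA).

For a finite family of *atoms* `e ∈ E` with values `κ e : ℝ` and weights `w e ≥ 1` such that
`w e = 1 → κ e = 1/2`, the *placement polynomial*
  `H_E(X) = Σ_{Q ⊆ E} (∏_{e ∈ E \ Q} κ e) · [X]_{|E \ Q|} · [(t − X)/2]_{|Q|}`,  `[Z]_m := ∏_{j<m} (Z − j)`,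
has `natDegree ≤ (Σ_e w e) / 2` (`natDegree_placement_le`).
Mechanism (`placement_insert`): `H_{E+j} = (κ_j·X + (t−X)/2)·H_E − Σ_{e∈E} H_E[κ_e ↦ κ_e·κ_j]` — the new atom sits on a
crossing position (`κ_j·[X]`), on an internal position (`[(t−X)/2]`), or collides with an old atom (merge); the linear
factor `κ_j X + (t−X)/2` is the CONSTANT `t/2` exactly for weight-one atoms (`κ_j = 1/2`), and a merged atom has weight
`≥ 2`, so the degree grows by at most `w_j / 2` per atom.
Part B (`ChebyshevTracialDesignHalfDegree`) identifies `H_E` — atoms = the edges of a perfect matching meeting a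
vertex set `A`, `κ = 1/2` on edges met once, `κ = 0` on edges inside `A`, `w e = |A ∩ e|` — with the level sums of the
monomial `U ↦ 1[A ⊆ U]`, giving `deg_c E[x_A | cc(U,M) = c] ≤ ⌊|A|/2⌋` (p1's half-degree lemma, there proved with
exp/log power series; here by this finite recursion).
No definitions: the polynomial is written out in every statement.
-/

set_option linter.dupNamespace false -- `Summit.PneNP.PneNP.…`: summit = sub-problem (D-0017)

namespace Summit.PneNP.PneNP.Theorems.ChebyshevTracialDesignHalfDegree

open Finset Polynomial

variable {α : Type*} [DecidableEq α]

/-- `insert j E \ insert j Q = E \ Q` when `j ∉ E`. [folklore] -/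
theorem insert_sdiff_insert_eq {E Q : Finset α} {j : α} (hj : j ∉ E) :
    insert j E \ insert j Q = E \ Q := by
  ext e
  simp only [mem_sdiff, mem_insert, not_or]
  constructor
  · rintro ⟨h | h, hne, hQ⟩
    · exact absurd h hne
    · exact ⟨h, hQ⟩
  · rintro ⟨hE, hQ⟩
    exact ⟨Or.inr hE, fun h => hj (h ▸ hE), hQ⟩

/-- The falling factorial step `[X]_{m+1} = [X]_m · (X − m)`. [folklore] -/
theorem prod_range_X_sub_succ (m : ℕ) :
    (∏ j ∈ range (m + 1), (X - C ((j : ℕ) : ℝ))) = (∏ j ∈ range m, (X - C ((j : ℕ) : ℝ))) * (X - C (m : ℝ)) :=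
  prod_range_succ _ m

/-- The collision sum: replacing `κ_e` by `κ_e κ_j` in `∏_{e' ∈ E \ Q} κ_{e'}` and summing over `e ∈ E` gives
`|E \ Q|·κ_j·∏ + |Q|·∏` (for `Q ⊆ E`). [folklore] -/
theorem sum_prod_update_mul {E Q : Finset α} (hQ : Q ⊆ E) (κ : α → ℝ) (b : ℝ) :
    ∑ e ∈ E, (∏ e' ∈ E \ Q, Function.update κ e (κ e * b) e') =
      ((E \ Q).card : ℝ) * (b * ∏ e' ∈ E \ Q, κ e') + (Q.card : ℝ) * ∏ e' ∈ E \ Q, κ e' := by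
  rw [← sum_sdiff hQ]
  congr 1
  · rw [← nsmul_eq_mul, ← sum_const]
    refine sum_congr rfl fun e he => ?_
    rw [prod_update_of_mem he, ← mul_prod_erase (E \ Q) κ he, sdiff_singleton_eq_erase]
    ring
  · rw [← nsmul_eq_mul, ← sum_const]
    refine sum_congr rfl fun e he => ?_
    have : e ∉ E \ Q := fun h => (mem_sdiff.1 h).2 he
    rw [prod_update_of_notMem this]

/-- **Atom recursion** for the placement polynomial
`H_E = Σ_{Q ⊆ E} (∏_{E\Q} κ)·[X]_{|E\Q|}·[(t−X)/2]_{|Q|}`: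
`H_{E+j} = (κ_j X + (t−X)/2)·H_E − Σ_{e∈E} H_E[κ_e ↦ κ_e κ_j]`. [folklore] -/
theorem placement_insert (E : Finset α) {j : α} (hj : j ∉ E) (κ : α → ℝ) (t : ℝ) :
    (∑ Q ∈ (insert j E).powerset, C (∏ e ∈ insert j E \ Q, κ e) *
        ((∏ i ∈ range (insert j E \ Q).card, (X - C ((i : ℕ) : ℝ))) *
          ∏ i ∈ range Q.card, (C (t / 2 - ((i : ℕ) : ℝ)) - C (1 / 2 : ℝ) * X))) =
      (C (κ j) * X + (C (t / 2) - C (1 / 2 : ℝ) * X)) *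
          (∑ Q ∈ E.powerset, C (∏ e ∈ E \ Q, κ e) *
            ((∏ i ∈ range (E \ Q).card, (X - C ((i : ℕ) : ℝ))) *
              ∏ i ∈ range Q.card, (C (t / 2 - ((i : ℕ) : ℝ)) - C (1 / 2 : ℝ) * X))) -
        ∑ e ∈ E, ∑ Q ∈ E.powerset, C (∏ e' ∈ E \ Q, Function.update κ e (κ e * κ j) e') *
            ((∏ i ∈ range (E \ Q).card, (X - C ((i : ℕ) : ℝ))) *
              ∏ i ∈ range Q.card, (C (t / 2 - ((i : ℕ) : ℝ)) - C (1 / 2 : ℝ) * X)) := by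
  rw [sum_powerset_insert hj, sum_comm, mul_sum, ← sum_sub_distrib, ← sum_add_distrib]
  refine sum_congr rfl fun Q hQ => ?_
  have hQE : Q ⊆ E := mem_powerset.1 hQ
  have hjQ : j ∉ Q := fun h => hj (hQE h)
  have hjEQ : j ∉ E \ Q := fun h => hj (mem_sdiff.1 h).1
  rw [insert_sdiff_of_notMem E hjQ, prod_insert hjEQ, card_insert_of_notMem hjEQ,
    insert_sdiff_insert_eq hj, card_insert_of_notMem hjQ, prod_range_X_sub_succ, prod_range_succ, ← sum_mul,
    ← map_sum C, sum_prod_update_mul hQE]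
  simp only [map_add, map_mul, map_sub, map_natCast]
  ring

/-- **Degree bound for the placement polynomial** (the algebraic half-degree lemma): if every atom has weight
`w e ≥ 1` and the weight-one atoms have `κ e = 1/2`, then
`natDegree (Σ_{Q ⊆ E} (∏_{E\Q} κ)·[X]_{|E\Q|}·[(t−X)/2]_{|Q|}) ≤ (Σ_{e∈E} w e) / 2`. [folklore] -/
theorem natDegree_placement_le (t : ℝ) (E : Finset α) :
    ∀ (κ : α → ℝ) (w : α → ℕ), (∀ e ∈ E, 1 ≤ w e) → (∀ e ∈ E, w e = 1 → κ e = 1 / 2) →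
      (∑ Q ∈ E.powerset, C (∏ e ∈ E \ Q, κ e) *
          ((∏ i ∈ range (E \ Q).card, (X - C ((i : ℕ) : ℝ))) *
            ∏ i ∈ range Q.card, (C (t / 2 - ((i : ℕ) : ℝ)) - C (1 / 2 : ℝ) * X))).natDegree ≤
        (∑ e ∈ E, w e) / 2 := by
  induction E using Finset.induction_on with
  | empty =>
    intro κ w _ _
    simp
  | insert j E hj ih =>
    intro κ w hw hκ
    rw [placement_insert E hj κ t, sum_insert hj]
    have hwj : 1 ≤ w j := hw j (mem_insert_self j E)
    have hwE : ∀ e ∈ E, 1 ≤ w e := fun e he => hw e (mem_insert_of_mem he)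
    have hκE : ∀ e ∈ E, w e = 1 → κ e = 1 / 2 := fun e he => hκ e (mem_insert_of_mem he)
    set W := ∑ e ∈ E, w e with hW
    set L : Polynomial ℝ := C (κ j) * X + (C (t / 2) - C (1 / 2 : ℝ) * X) with hL
    set H : Polynomial ℝ := ∑ Q ∈ E.powerset, C (∏ e ∈ E \ Q, κ e) *
        ((∏ i ∈ range (E \ Q).card, (X - C ((i : ℕ) : ℝ))) *
          ∏ i ∈ range Q.card, (C (t / 2 - ((i : ℕ) : ℝ)) - C (1 / 2 : ℝ) * X)) with hH
    -- the main term
    have hdegH : H.natDegree ≤ W / 2 := ih κ w hwE hκE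
    have hlin : L.natDegree + W / 2 ≤ (w j + W) / 2 := by
      by_cases h1 : w j = 1
      · have : L = C (t / 2) := by
          rw [hL, hκ j (mem_insert_self j E) h1]; ring
        rw [this, natDegree_C]
        omega
      · have : L.natDegree ≤ 1 := by
          have e1 : L = C (κ j - 1 / 2) * X + C (t / 2) := by
            rw [hL]; simp only [map_sub]; ring
          rw [e1]
          refine (natDegree_add_le _ _).trans (max_le ((natDegree_C_mul_le _ _).trans natDegree_X_le) ?_)
          simp
        omega
    have hmain : (L * H).natDegree ≤ (w j + W) / 2 :=
      natDegree_mul_le.trans ((Nat.add_le_add_left hdegH _).trans hlin)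
    -- the collision terms
    have hcoll : (∑ e ∈ E, ∑ Q ∈ E.powerset, C (∏ e' ∈ E \ Q, Function.update κ e (κ e * κ j) e') *
        ((∏ i ∈ range (E \ Q).card, (X - C ((i : ℕ) : ℝ))) *
          ∏ i ∈ range Q.card, (C (t / 2 - ((i : ℕ) : ℝ)) - C (1 / 2 : ℝ) * X))).natDegree ≤ (w j + W) / 2 := by
      refine natDegree_sum_le_of_forall_le _ _ fun e he => ?_
      have hw' : ∀ e' ∈ E, 1 ≤ Function.update w e (w e + w j) e' := by
        intro e' he'
        rcases eq_or_ne e' e with rfl | hne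
        · rw [Function.update_self]; exact le_add_right (hwE e' he')
        · rw [Function.update_of_ne hne]; exact hwE e' he'
      have hκ' : ∀ e' ∈ E, Function.update w e (w e + w j) e' = 1 →
          Function.update κ e (κ e * κ j) e' = 1 / 2 := by
        intro e' he' h1
        rcases eq_or_ne e' e with rfl | hne
        · rw [Function.update_self] at h1
          have := hwE e' he'
          omega
        · rw [Function.update_of_ne hne] at h1 ⊢
          exact hκE e' he' h1
      refine (ih _ _ hw' hκ').trans ?_
      have hsum : ∑ e' ∈ E, Function.update w e (w e + w j) e' = w j + W := by
        rw [sum_update_of_mem he, hW, ← add_sum_erase E w he, sdiff_singleton_eq_erase]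
        ring
      rw [hsum]
    exact (natDegree_sub_le _ _).trans (max_le hmain hcoll)

end Summit.PneNP.PneNP.Theorems.ChebyshevTracialDesignHalfDegree
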